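import Summits.KontsevichZagierPeriods.KontsevichZagierPeriods.Theorems.TerasomaMultiplicationBetaCancellationWeightDescent
import Summits.KontsevichZagierPeriods.KontsevichZagierPeriods.Theorems.LiouvilleUnfoldingAyoubPiCancellationStubStripWeight
import Summits.KontsevichZagierPeriods.KontsevichZagierPeriods.Theorems.LiouvilleUnfoldingAyoubPiCancellationStubStripConst

/-!
# Crux stmt-KontsevichZagierPeriods-0540 (`LiouvilleUnfolding.AyoubPiCancellation` ≡ `KZ.PiCancellation`),
# line `Sketch` (idea `moving-segment-wronskian`): stub `stub_stripDescent`

Support file (`--supports` stmt-KontsevichZagierPeriods-0540) of the line skeleton, registered stub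
`stub_stripDescent` (S, glue): **`π`-cancellation for STRIP-RESPECTING certificates**, the first
certificate class the line certifies.

Fix an interior strip `-1 < a < b < 1` (`a b` rational). A rule-(2) substitution `Φ` on `r.domain`
is STRIP-RESPECTING if it moves no point across a wall `z₀ = q` with `q ∈ (a, b)`:
`Φ x 0 < q ↔ x 0 < q` for all `x ∈ r.domain` and all `a < q < b`. If a certificate of `[π]·c`
(pinned disc family `P`) lies in the closure of additivity (rules (1)), Newton–Leibniz over bases
of dimension `≥ 1` and strip-respecting substitutions, then `c ∈ relations`.

Proof. A strip-respecting substitution PRESERVES THE STRIP WEIGHT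
`w_{a,b}(t) = 𝟙_{(a,b)}(t) / (2√(1 − t²))` of the first coordinate
(`stripDescent_indicator_eq`, pure real analysis: if `u` and `v` lie on the same side of every
wall `q ∈ (a, b)` then either `u = v ∈ (a, b)` or both lie off `(a, b)`, so
`𝟙_{(a,b)} g (u) = 𝟙_{(a,b)} g (v)` for every `g`). Hence the strip-respecting closure is
contained in the `w_{a,b}`-preserving closure (`AddSubgroup.closure_mono`), and the master theorem
`BetaCancellationLine.weightDescent`
(`Theorems/TerasomaMultiplicationBetaCancellationWeightDescent.lean`) applies: the weight is
admissible by `stub_stripWeight` (semialgebraic on `ℝ¹`, bounded), and the weighted disc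
`[D, w_{a,b}]` of `stub_stripConst` finishes, being worth the non-zero rational constant `b − a`
against every factor
(`BetaCancellationLine.mem_relations_of_of_mul_mem_of_forall_prod_equivalent`).
No definitions; sorry-free; axioms ⊆ {propext, Classical.choice, Quot.sound}.

References: M. Kontsevich, D. Zagier, *Periods* (2001), §1.2 (rules (1)–(3)), §4.1; J. Ayoub,
*Une version relative de la conjecture des périodes de Kontsevich–Zagier*, Ann. of Math. 181
(2015), §1.
-/

noncomputable section

-- `Summit.KontsevichZagierPeriods.KontsevichZagierPeriods.…` is the tree's mandated layout (single-conjunct summit).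
set_option linter.dupNamespace false

namespace Summit.KontsevichZagierPeriods.KontsevichZagierPeriods.AyoubPiCancellationLine

open Set
open Literature.NumberTheory.Transcendental
open Literature.NumberTheory.Transcendental.KZ
open Summit.KontsevichZagierPeriods.KontsevichZagierPeriods.BetaCancellationLine
  (weightDescent mem_relations_of_of_mul_mem_of_forall_prod_equivalent)

-- adapted from Summits/KontsevichZagierPeriods/KontsevichZagierPeriods/Theorems/TerasomaMultiplicationBetaCancellationWeightDescent.lean
-- (`weight_ayoubPiCancellation` with the strip weight; closure bookkeeping of
-- `piMul_mem_weightClosure`)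

/-! ### The key lemma: same side of every interior wall ⇒ same value of every strip cut-off -/

/-- **Same side of every wall of `(a, b)` forces the same `(a, b)`-cut-off value.** If `a < b` and
two reals `u`, `v` satisfy `u < q ↔ v < q` for every `q ∈ (a, b)`, then for every `g : ℝ → ℝ` the
extensions by zero off `(a, b)` agree: `𝟙_{(a,b)} g (u) = 𝟙_{(a,b)} g (v)`. Indeed if `v ∈ (a, b)`
then `u = v` (test the midpoint between `v` and `max a u`, resp. `min b u`); if `v ≤ a` then `u ≤ a`
and if `b ≤ v` then `b ≤ u` (test the midpoint between the endpoint and `u` clipped to `(a, b)`),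
and in the last two cases both values are `0`. [folklore] -/
theorem stripDescent_indicator_eq {a b : ℝ} (hab : a < b) (g : ℝ → ℝ) {u v : ℝ}
    (h : ∀ q : ℝ, a < q → q < b → (u < q ↔ v < q)) :
    (Set.Ioo a b).indicator g u = (Set.Ioo a b).indicator g v := by
  rcases lt_or_ge a v with hav | hva
  · rcases lt_or_ge v b with hvb | hbv
    · -- `v ∈ (a, b)`: then `u = v`
      have huv : u = v := by
        rcases lt_trichotomy u v with huv | huv | huv
        · exfalso
          have hm : max a u < v := max_lt hav huv
          have h1 : a ≤ max a u := le_max_left a u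
          have h2 : u ≤ max a u := le_max_right a u
          have hq := (h ((max a u + v) / 2) (by linarith) (by linarith)).1 (by linarith)
          linarith
        · exact huv
        · exfalso
          have hm : v < min b u := lt_min hvb huv
          have h1 : min b u ≤ b := min_le_left b u
          have h2 : min b u ≤ u := min_le_right b u
          have hq := (h ((v + min b u) / 2) (by linarith) (by linarith)).2 (by linarith)
          linarith
      rw [huv]
    · -- `b ≤ v`: then `b ≤ u`, both values vanish
      have hbu : b ≤ u := by
        by_contra hub
        rw [not_le] at hub
        have hm : max a u < b := max_lt hab hub
        have h1 : a ≤ max a u := le_max_left a u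
        have h2 : u ≤ max a u := le_max_right a u
        have hq := (h ((max a u + b) / 2) (by linarith) (by linarith)).1 (by linarith)
        linarith
      rw [indicator_of_notMem (fun hu : u ∈ Set.Ioo a b => (not_lt.2 hbu) hu.2),
        indicator_of_notMem (fun hv : v ∈ Set.Ioo a b => (not_lt.2 hbv) hv.2)]
  · -- `v ≤ a`: then `u ≤ a`, both values vanish
    have hua : u ≤ a := by
      by_contra hau
      rw [not_le] at hau
      have hm : a < min u b := lt_min hau hab
      have h1 : min u b ≤ u := min_le_left u b
      have h2 : min u b ≤ b := min_le_right u b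
      have hq := (h ((a + min u b) / 2) (by linarith) (by linarith)).2 (by linarith)
      linarith
    rw [indicator_of_notMem (fun hu : u ∈ Set.Ioo a b => (not_lt.2 hua) hu.1),
      indicator_of_notMem (fun hv : v ∈ Set.Ioo a b => (not_lt.2 hva) hv.1)]

/-! ### The stub -/

/-- **STUB `stub_stripDescent`** (S, glue) of the line `Sketch`: **`π`-cancellation for
STRIP-RESPECTING certificates.** If a certificate of `[π]·c` (pinned disc family `P`) lies in the
closure of additivity, Newton–Leibniz over bases of dimension `≥ 1`, and rule-(2) substitutions none
of which moves a point across a wall `z₀ = q` with `q` in the interior strip `(a, b)`,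
`-1 < a < b < 1`, then `c ∈ relations`. Strip-respecting substitutions preserve the strip weight
`w_{a,b}(z₀) = 𝟙_{(a,b)}(z₀) / (2√(1 − z₀²))` (`stripDescent_indicator_eq`), so
`BetaCancellationLine.weightDescent` applies with the admissible weight of `stub_stripWeight` and
the finishing weighted disc `[D, w_{a,b}] ∼ b − a ≠ 0` of `stub_stripConst`
(`BetaCancellationLine.mem_relations_of_of_mul_mem_of_forall_prod_equivalent`). [folklore] -/
theorem stub_stripDescent : ∀ (a b : ℚ), -1 < a → a < b → b < 1 →
    ∀ (P : ∀ n : ℕ, IntegralRep n → IntegralRep (n + 2)),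
      (∀ (n : ℕ) (r : IntegralRep n),
        (P n r).domain = {z : Fin (n + 2) → ℝ | z 0 ^ 2 + z 1 ^ 2 ≤ 1 ∧
          (fun i : Fin n => z i.succ.succ) ∈ r.domain} ∧
        (P n r).integrand = fun z => r.integrand (fun i : Fin n => z i.succ.succ)) →
      ∀ (c : FormalRep),
        FreeAbelianGroup.lift (fun s : (Σ n, IntegralRep n) => of (P s.1 s.2)) c ∈
          AddSubgroup.closure (domainAddRel ∪ integrandAddRel ∪
          {x | ∃ (n : ℕ) (r r' : IntegralRep (n + 1)) (Φ : (Fin (n + 1) → ℝ) → (Fin (n + 1) → ℝ))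
              (Φ' : (Fin (n + 1) → ℝ) → (Fin (n + 1) → ℝ) →L[ℝ] (Fin (n + 1) → ℝ)),
            IsSemialgebraicMapOn ℚ r.domain Φ ∧
            (∀ x ∈ r.domain, HasFDerivWithinAt Φ (Φ' x) r.domain x) ∧ Set.InjOn Φ r.domain ∧
            r'.domain = Φ '' r.domain ∧
            (∀ x ∈ r.domain, r.integrand x = r'.integrand (Φ x) * |(Φ' x).det|) ∧
            (∀ x ∈ r.domain, ∀ q : ℝ, (a : ℝ) < q → q < b → (Φ x 0 < q ↔ x 0 < q)) ∧
            x = of r - of r'} ∪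
          fibredNewtonLeibnizRel) →
        c ∈ relations := by
  intro a b ha hab hb P hP c hc
  -- the admissible weight (semialgebraic on `ℝ¹`, bounded)
  obtain ⟨hw, C, hC⟩ := stub_stripWeight a b ha hab hb
  -- the finishing weighted disc `[D, w_{a,b}] ∼ b - a`
  obtain ⟨Dw, hDw, hDw1, hDwc⟩ := stub_stripConst a b ha hab hb
  have hκ : IsAlgebraic ℚ ((b - a : ℚ) : ℝ) := by
    have h := isAlgebraic_algebraMap (R := ℚ) (A := ℝ) (b - a : ℚ)
    rwa [eq_ratCast] at h
  have hκ0 : ((b - a : ℚ) : ℝ) ≠ 0 := by exact_mod_cast (sub_pos.2 hab).ne'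
  have hfin : ∀ c : FormalRep, of Dw * c ∈ relations → of piRep * c ∈ relations → c ∈ relations :=
    fun c hc _ => mem_relations_of_of_mul_mem_of_forall_prod_equivalent Dw hκ hκ0 (hDwc hκ) c hc
  have hab' : (a : ℝ) < b := by exact_mod_cast hab
  -- strip-respecting ⇒ `w_{a,b}`-preserving, generator by generator
  refine weightDescent
    ((Set.Ioo (a : ℝ) b).indicator (fun t => 1 / (2 * Real.sqrt (1 - t ^ 2)))) hw C hC hDw hDw1
    hfin P hP c (AddSubgroup.closure_mono ?_ hc)
  rintro y (((hy | hy) | hy) | hy)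
  · exact Or.inl (Or.inl (Or.inl hy))
  · exact Or.inl (Or.inl (Or.inr hy))
  · obtain ⟨k, r, r', Φ, Φ', hΦ, hΦ', hinj, hdom, hf, hstrip, rfl⟩ := hy
    exact Or.inl (Or.inr ⟨k, r, r', Φ, Φ', hΦ, hΦ', hinj, hdom, hf,
      fun x hx => stripDescent_indicator_eq hab' _ (hstrip x hx), rfl⟩)
  · exact Or.inr hy

end Summit.KontsevichZagierPeriods.KontsevichZagierPeriods.AyoubPiCancellationLine
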